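import Mathlib.Analysis.SpecialFunctions.Trigonometric.Bounds
import Literature.Topology.FourManifolds.MMSWTwistedPictureConstants
import Literature.Topology.FourManifolds.SmoothTransitionFlatEnds
import HarnessLib

/-!
# The twisted pictures are eventually in general position

Sibling of `MMSWTwistedPictureConstants.lean`; last step of "the twisted pictures
`D(0⃗)(stripTwistAt_k ∘ K)` are in general position for all large `k`" towards the named fact
`Literature.Topology.FourManifolds.MMSW.eventually_approxHasRasmussen` (Manolescu–Marengon–
Sarkar–Willis, arXiv:1910.08195, Thm. 1.4 / Prop. 8.2 (i); §8.1 in the tree's picture).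

* `twisted_transverse_new` — **the NEW double points are transverse for `k ≥ k₁`.**  At a new
  double point (upper `s`, lower `t`, `Re z(s) = Re z(t) = x₀` in the open window of band `j`) the
  twisted velocities are `V_s = (c'(s) + iλ c(s)) m`, `V_t = c'(t)` with `m = e^{2πik S(u₀)}`,
  `λ = 2πk S'(u₀) f'(s)/(2w)`, and `cross (V_s, V_t) · |c|² = ρ f'(s) ω_t - (ω_s + λ ρ²) ρ f'(t)`
  (`ω = Im (conj c · c')`, `ρ = |c|`).  By `smoothTransition_fast_or_flat` either the step is FAST
  at `u₀` — then `λρ²` beats the angular terms (`exists_bound_angular`) and the cross product is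
  nonzero — or `m` is within `δ₀/ρ_max` of `1`, so `‖c(s) - c(t)‖ = |c(s)| |m - 1| < δ₀`,
  contradicting `exists_lowerBound_dist_upper_lower`: no such double point exists;
* `hcross_of_crossingSet` — the closed-window crossing-value hypothesis from the form produced by
  `MMSWBandGenericity.exists_generic_bands`;
* `eventually_inGeneralPosition_twisted` — **assembly**: with `D(0⃗)(K)` in general position and
  generic bands, `D(0⃗)(stripTwistAt_k ∘ K)` is in general position for every `k ≥ k₁`
  (immersion: `deriv_planeCurve_twisted_ne_zero`; transversality: old/new; no triple points:
  `twisted_no_triple`), so `InGeneralPosition.hasGaussDiagram` applies to it.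

Everything is proved; no definitions, no named facts.

## References

* C. Manolescu, M. Marengon, S. Sarkar, M. Willis, Duke Math. J. 172 (2023), arXiv:1910.08195,
  §2.1 and §8.1. [ManolescuMarengonSarkarWillis2023]
* P. R. Cromwell, *Knots and Links*, CUP (2004), §3.2 (regular projections). [Cromwell2004]
-/

open scoped Manifold ContDiff Topology ComplexConjugate
open Function Set Filter Complex

noncomputable section

namespace Literature.Topology.FourManifolds

/-- Local notation: `𝔼 n` is the model Euclidean space `EuclideanSpace ℝ (Fin n)`. -/
local notation "𝔼 " n:arg => EuclideanSpace ℝ (Fin n)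

/-- Local notation: `𝕊 n` is the unit sphere in `EuclideanSpace ℝ (Fin (n + 1))`. -/
local notation "𝕊 " n:arg => (Metric.sphere (0 : EuclideanSpace ℝ (Fin (n + 1))) 1)

namespace MMSW

open Literature.AlgebraicTopology.Homotopy.HopfFibration (zC wC ofZW zC_ofZW wC_ofZW ofZW_zC_wC)

variable {r : ℕ}

/-! ## Complex bookkeeping for the cross product at a new double point -/

/-- `Im (conj a · A) = |P|² · Im (conj V_s · V_t)` for `a = conj P · V_s`, `A = conj P · V_t`.
[folklore] -/
theorem im_conj_mul_frame (P Vs Vt : ℂ) :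
    (conj (conj P * Vs) * (conj P * Vt)).im = Complex.normSq P * (conj Vs * Vt).im := by
  have h : conj (conj P * Vs) * (conj P * Vt) = (Complex.normSq P : ℂ) * (conj Vs * Vt) := by
    rw [map_mul, Complex.conj_conj, ← Complex.mul_conj]; ring
  rw [h, Complex.im_ofReal_mul]

/-- The frame coordinate of the upper twisted velocity:
`conj (c m) · ((v + iλ c) m) = conj c · v + iλ |c|²` for a unit `m`. [folklore] -/
theorem frame_upper (c v m : ℂ) (lam : ℝ) (hm : ‖m‖ = 1) :
    conj (c * m) * ((v + c * ((lam : ℂ) * I)) * m) =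
      conj c * v + ((lam * Complex.normSq c : ℝ) : ℂ) * I := by
  have hmm : conj m * m = 1 := by
    rw [mul_comm, Complex.mul_conj, Complex.normSq_eq_norm_sq, hm]; simp
  have hcc : conj c * c = (Complex.normSq c : ℂ) := by rw [mul_comm, Complex.mul_conj]
  rw [map_mul]
  push_cast
  linear_combination (conj c * (v + c * ((lam : ℂ) * I))) * hmm + ((lam : ℂ) * I) * hcc

/-- Real and imaginary parts of `x + iy·(real)`. [folklore] -/
theorem re_add_real_mul_I (x : ℂ) (y : ℝ) : (x + (y : ℂ) * I).re = x.re := by simp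

/-- Imaginary part of `x + iy·(real)`. [folklore] -/
theorem im_add_real_mul_I (x : ℂ) (y : ℝ) : (x + (y : ℂ) * I).im = x.im + y := by simp

/-- The chord is shorter than the arc: `‖e^{iy} - 1‖ ≤ |y|`. [folklore] -/
theorem norm_exp_mul_I_sub_one_le (y : ℝ) : ‖exp ((y : ℂ) * I) - 1‖ ≤ |y| := by
  have h := Real.norm_exp_I_mul_ofReal_sub_one_le (x := y)
  rw [mul_comm] at h
  simpa [Real.norm_eq_abs] using h

/-- The derivative of the band step in terms of the smooth step. [folklore] -/
theorem deriv_bandStep (w x : ℝ) :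
    deriv (bandStep w) x = deriv Real.smoothTransition ((x + w) / (2 * w)) / (2 * w) := by
  have h1 : HasDerivAt (fun y : ℝ ↦ (y + w) / (2 * w)) (1 / (2 * w)) x := by
    simpa using ((hasDerivAt_id x).add_const w).div_const (2 * w)
  have h2 : HasDerivAt Real.smoothTransition (deriv Real.smoothTransition ((x + w) / (2 * w)))
      ((x + w) / (2 * w)) :=
    ((Real.smoothTransition.contDiff (n := 1)).differentiable one_ne_zero _).hasDerivAt
  have h := HasDerivAt.comp (h₂ := Real.smoothTransition) (h := fun y : ℝ ↦ (y + w) / (2 * w)) x h2 h1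
  have heq : (Real.smoothTransition ∘ fun y : ℝ ↦ (y + w) / (2 * w)) = bandStep w := by
    funext y; simp [bandStep]
  rw [heq] at h
  rw [h.deriv]; ring


/-- `chartC` of the chart curve depends only on the plane-curve point (two knots). [folklore] -/
theorem chartC_stereoCurve_congr {K₁ K₂ : Knot} {θ₁ θ₂ : ℝ}
    (h : K₁.planeCurve θ₁ = K₂.planeCurve θ₂) :
    chartC (K₁.stereoCurve θ₁) = chartC (K₂.stereoCurve θ₂) := by
  rw [Knot.planeCurve_eq_fst_comp, Knot.planeCurve_eq_fst_comp, comp_apply, comp_apply] at h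
  apply Complex.ext
  · rw [chartC_re, chartC_re, h]
  · rw [chartC_im, chartC_im, h]

/-- A small full-turn phase is close to `1`: `‖e^{2πikS i} - 1‖ < ε` if `2πkS < ε`, `S ≥ 0`.
[folklore] -/
theorem norm_exp_phase_sub_one_lt_left {k : ℕ} {S ε : ℝ} (hS : 0 ≤ S)
    (h : 2 * Real.pi * k * S < ε) :
    ‖exp (((2 * Real.pi * k * S : ℝ) : ℂ) * I) - 1‖ < ε := by
  have h0 : 0 ≤ 2 * Real.pi * k * S := by positivity
  calc ‖exp (((2 * Real.pi * k * S : ℝ) : ℂ) * I) - 1‖ ≤ |2 * Real.pi * k * S| :=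
        norm_exp_mul_I_sub_one_le _
    _ = 2 * Real.pi * k * S := abs_of_nonneg h0
    _ < ε := h

/-- A nearly full-turn phase is close to `1`: `‖e^{2πikS i} - 1‖ < ε` if `2πk(1 - S) < ε`,
`S ≤ 1` (because `e^{2πik i} = 1`). [folklore] -/
theorem norm_exp_phase_sub_one_lt_right {k : ℕ} {S ε : ℝ} (hS : S ≤ 1)
    (h : 2 * Real.pi * k * (1 - S) < ε) :
    ‖exp (((2 * Real.pi * k * S : ℝ) : ℂ) * I) - 1‖ < ε := by
  have h0 : 0 ≤ 2 * Real.pi * k * (1 - S) := by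
    have : 0 ≤ 1 - S := by linarith
    positivity
  have hper : exp (((2 * Real.pi * k : ℝ) : ℂ) * I) = 1 := by
    have := Complex.exp_nat_mul_two_pi_mul_I k
    rw [← this]; congr 1; push_cast; ring
  have heq : exp (((2 * Real.pi * k * S : ℝ) : ℂ) * I) =
      exp (((-(2 * Real.pi * k * (1 - S)) : ℝ) : ℂ) * I) := by
    rw [show ((2 * Real.pi * k * S : ℝ) : ℂ) * I =
      ((-(2 * Real.pi * k * (1 - S)) : ℝ) : ℂ) * I + ((2 * Real.pi * k : ℝ) : ℂ) * I by
        push_cast; ring, Complex.exp_add, hper, mul_one]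
  rw [heq]
  calc ‖exp (((-(2 * Real.pi * k * (1 - S)) : ℝ) : ℂ) * I) - 1‖
      ≤ |-(2 * Real.pi * k * (1 - S))| := norm_exp_mul_I_sub_one_le _
    _ = 2 * Real.pi * k * (1 - S) := by rw [abs_neg, abs_of_nonneg h0]
    _ < ε := h

/-- **The slow case is impossible**: if `cs · m = ct`, `|cs| ≤ ρ_max`, `‖m - 1‖ < δ₀/ρ_max`
then `‖cs - ct‖ < δ₀`. [folklore] -/
theorem norm_sub_lt_of_phase_close {cs ct m : ℂ} {δ₀ ρmax : ℝ} (hP : cs * m = ct)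
    (hρmax : 0 < ρmax) (hcs : ‖cs‖ ≤ ρmax) (hm : ‖m - 1‖ < δ₀ / ρmax) : ‖cs - ct‖ < δ₀ := by
  rw [← hP, show cs - cs * m = cs * (1 - m) by ring, norm_mul, norm_sub_rev]
  have h0 : 0 ≤ ‖m - 1‖ := norm_nonneg _
  calc ‖cs‖ * ‖m - 1‖ ≤ ρmax * ‖m - 1‖ := by gcongr
    _ < ρmax * (δ₀ / ρmax) := by gcongr
    _ = δ₀ := by field_simp

/-- **The fast case forces transversality** (pure algebra).  In the frame of the double point,
`ρ f'(s) ω_t - (ω_s + λ ρ²) ρ f'(t) = 0` with angular parts bounded by `M₀ |f'|` and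
`λ = D f'(s)`, `D ρ² > 2 M₀`, is impossible. [folklore] -/
theorem fast_case_absurd {ωs ωt fs ft ρ lam M₀ D : ℝ}
    (hzero : ρ * fs * ωt - (ωs + lam * ρ ^ 2) * (ρ * ft) = 0) (hρ : 0 < ρ)
    (has : |ωs| ≤ M₀ * |fs|) (hat : |ωt| ≤ M₀ * |ft|) (hfs : fs ≠ 0) (hft : ft ≠ 0)
    (hlam : lam = D * fs) (hD : 2 * M₀ < D * ρ ^ 2) (hD0 : 0 ≤ D) : False := by
  have key : fs * ωt - ωs * ft = D * ρ ^ 2 * (fs * ft) := by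
    have h : ρ * (fs * ωt - ωs * ft - lam * ρ ^ 2 * ft) = 0 := by linear_combination hzero
    have h2 : fs * ωt - ωs * ft - lam * ρ ^ 2 * ft = 0 := by
      rcases mul_eq_zero.1 h with h | h
      · exact absurd h hρ.ne'
      · exact h
    rw [hlam] at h2; linear_combination h2
  have hL : |fs * ωt - ωs * ft| ≤ 2 * M₀ * (|fs| * |ft|) := by
    have h1 : |fs * ωt| ≤ |fs| * (M₀ * |ft|) := by rw [abs_mul]; gcongr
    have h2 : |ωs * ft| ≤ (M₀ * |fs|) * |ft| := by rw [abs_mul]; gcongr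
    calc |fs * ωt - ωs * ft| ≤ |fs * ωt| + |ωs * ft| := abs_sub _ _
      _ ≤ |fs| * (M₀ * |ft|) + (M₀ * |fs|) * |ft| := add_le_add h1 h2
      _ = 2 * M₀ * (|fs| * |ft|) := by ring
  have hR : |fs * ωt - ωs * ft| = D * ρ ^ 2 * (|fs| * |ft|) := by
    rw [key, abs_mul, abs_mul, abs_mul, abs_of_nonneg hD0, abs_of_nonneg (sq_nonneg _)]
  have hprod : 0 < |fs| * |ft| := mul_pos (abs_pos.2 hfs) (abs_pos.2 hft)
  have h3 : 2 * M₀ * (|fs| * |ft|) < D * ρ ^ 2 * (|fs| * |ft|) := mul_lt_mul_of_pos_right hD hprod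
  linarith [hL, hR]

/-! ## The new double points are transverse for large `k` -/

/-- **The new double points of the twisted picture are transverse for all large `k`.**
[cite: ManolescuMarengonSarkarWillis2023, §8.1] -/
theorem twisted_transverse_new {K : 𝕊 1 → 𝔼 4} (hK : IsModelKnot r K) (hwK : ∀ t, wC (K t) ≠ 0)
    {K₃ : Knot} (hK₃ : ⇑K₃ = finiteApprox r 0 K) {w : ℝ} (hw : 0 < w) {e : Fin r → ℝ}
    (he : ∀ j, |e j| + w < 1)
    (hcross : ∀ s t, K₃.planeCurve s = K₃.planeCurve t → circlePoint s ≠ circlePoint t →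
      ∀ j : Fin r, (zC (K (circlePoint s))).re ∉
        Icc ((holeCentre r j).re + e j - w) ((holeCentre r j).re + e j + w))
    (hcrit : ∀ (j : Fin r) (θ : ℝ), deriv (fun θ : ℝ ↦ (zC (K (circlePoint θ))).re) θ = 0 →
      (zC (K (circlePoint θ))).re ∉
        Icc ((holeCentre r j).re + e j - w) ((holeCentre r j).re + e j + w)) :
    ∃ k₁ : ℕ, ∀ k : ℕ, k₁ ≤ k → ∀ K₃k : Knot,
      ⇑K₃k = finiteApprox r 0 (stripTwistAt r (k : ℤ) w e ∘ K) →
      ∀ (s t : ℝ) (j : Fin r),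
        (zC (K (circlePoint s))).re ∈ Ioo ((holeCentre r j).re + e j - w) ((holeCentre r j).re + e j + w) →
        (zC (K (circlePoint t))).re = (zC (K (circlePoint s))).re →
        0 < (zC (K (circlePoint s))).im → (zC (K (circlePoint t))).im < 0 →
        K₃k.planeCurve s = K₃k.planeCurve t →
        cross (deriv K₃k.planeCurve s) (deriv K₃k.planeCurve t) ≠ 0 := by
  have hne : ∀ x, K₃ x ≠ northPole := fun x ↦ ne_northPole_of_coe_eq_finiteApprox hK₃ x
  -- the uniform constants
  obtain ⟨ρmin, ρmax, hρmin, hρ⟩ := exists_bounds_norm_chartC hK hwK hK₃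
  obtain ⟨M₀, hM₀, hang⟩ := exists_bound_angular hK hK₃ (w := w) (e := e) hcrit
  obtain ⟨δ₀, hδ₀, hdist⟩ := exists_lowerBound_dist_upper_lower hK hK₃ he hcross
  have hρmax : 0 < ρmax := lt_of_lt_of_le hρmin ((hρ 0).1.trans (hρ 0).2)
  obtain ⟨k₁, hk₁⟩ := smoothTransition_fast_or_flat hw (div_pos hδ₀ hρmax)
    (show (0 : ℝ) ≤ 2 * M₀ / ρmin ^ 2 by positivity)
  refine ⟨k₁, fun k hk K₃k hK₃k s t j hj hts hs ht hst ↦ ?_⟩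
  have hkk : ((k : ℤ) : ℝ) = (k : ℝ) := by simp
  have hnek : ∀ x, K₃k x ≠ northPole := fun x ↦ ne_northPole_of_coe_eq_finiteApprox hK₃k x
  have hjs : |(zC (K (circlePoint s))).re - (holeCentre r j).re - e j| < w := by
    rw [abs_lt]; constructor <;> [linarith [hj.1]; linarith [hj.2]]
  have hjs' : (zC (K (circlePoint s))).re ∈
      Icc ((holeCentre r j).re + e j - w) ((holeCentre r j).re + e j + w) := Ioo_subset_Icc_self hj
  have hjt' : (zC (K (circlePoint t))).re ∈
      Icc ((holeCentre r j).re + e j - w) ((holeCentre r j).re + e j + w) := by rw [hts]; exact hjs'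
  have hu₀mem : ((zC (K (circlePoint s))).re - (holeCentre r j).re - e j + w) / (2 * w) ∈
      Icc (0 : ℝ) 1 := by
    have h := hjs
    rw [abs_lt] at h
    constructor
    · exact div_nonneg (by linarith [h.1]) (by linarith)
    · rw [div_le_one (by linarith)]; linarith [h.2]
  -- the double point and the velocities in complex coordinates
  have hup := (twisted_chartC_eventuallyEq_upper hK hK₃ hw he hK₃k hjs hs).self_of_nhds
  dsimp only at hup
  have hlow : chartC (K₃k.stereoCurve t) = chartC (K₃.stereoCurve t) :=
    chartC_stereoCurve_congr (twisted_chartC_eventuallyEq_lower hK hK₃ hw hK₃k ht).self_of_nhds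
  have hPk : chartC (K₃k.stereoCurve s) = chartC (K₃k.stereoCurve t) := chartC_stereoCurve_congr hst
  have hVs' := (hasDerivAt_chartC_stereoCurve hnek s).unique
    (hasDerivAt_twisted_chartC_upper hK hK₃ hw he hK₃k hjs hs)
  have hVt' : deriv K₃k.planeCurve t = deriv K₃.planeCurve t :=
    (twisted_chartC_eventuallyEq_lower hK hK₃ hw hK₃k ht).deriv_eq
  have hm1 : ‖exp (((2 * Real.pi * ((k : ℤ) : ℝ) *
      bandStep w ((zC (K (circlePoint s))).re - (holeCentre r j).re - e j) : ℝ) : ℂ) * I)‖ = 1 :=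
    Complex.norm_exp_ofReal_mul_I _
  have hB' := deriv_bandStep w ((zC (K (circlePoint s))).re - (holeCentre r j).re - e j)
  -- radial identities, angular bounds, radius bounds, distance bound
  have hrs := re_conj_mul_deriv_chartC hK hwK hK₃ s
  have hrt := re_conj_mul_deriv_chartC hK hwK hK₃ t
  have has := hang s ⟨j, hjs'⟩
  have hat := hang t ⟨j, hjt'⟩
  have hfs0 : deriv (fun θ : ℝ ↦ (zC (K (circlePoint θ))).re) s ≠ 0 := fun h0 ↦ hcrit j s h0 hjs'
  have hft0 : deriv (fun θ : ℝ ↦ (zC (K (circlePoint θ))).re) t ≠ 0 := fun h0 ↦ hcrit j t h0 hjt'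
  have hρs : ‖chartC (K₃.stereoCurve s)‖ = (zC (K (circlePoint s))).re + drawRadius r :=
    norm_chartC_stereoCurve hK hwK hK₃ s
  have hρpos : 0 < (zC (K (circlePoint s))).re + drawRadius r := re_zC_add_drawRadius_pos (hK.mem _)
  have hnormSq : Complex.normSq (chartC (K₃.stereoCurve s)) =
      ((zC (K (circlePoint s))).re + drawRadius r) ^ 2 := by
    rw [Complex.normSq_eq_norm_sq, hρs]
  have hρmin_le : ρmin ≤ (zC (K (circlePoint s))).re + drawRadius r := by
    rw [← hρs]; exact (hρ s).1
  have hρmax_ge : ‖chartC (K₃.stereoCurve s)‖ ≤ ρmax := (hρ s).2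
  have hfar := hdist s t ⟨j, hjs'⟩ hts hs ht
  -- abbreviations
  set f : ℝ → ℝ := fun θ ↦ (zC (K (circlePoint θ))).re with hf
  set x₀ : ℝ := (zC (K (circlePoint s))).re - (holeCentre r j).re - e j with hx₀
  set u₀ : ℝ := (x₀ + w) / (2 * w) with hu₀
  set m : ℂ := exp (((2 * Real.pi * ((k : ℤ) : ℝ) * bandStep w x₀ : ℝ) : ℂ) * I) with hm
  set lam : ℝ := 2 * Real.pi * ((k : ℤ) : ℝ) * (deriv (bandStep w) x₀ * deriv f s) with hlam
  set cs : ℂ := chartC (K₃.stereoCurve s) with hcs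
  set ct : ℂ := chartC (K₃.stereoCurve t) with hct
  set vs : ℂ := chartC (deriv K₃.planeCurve s, 0) with hvs
  set vt : ℂ := chartC (deriv K₃.planeCurve t, 0) with hvt
  set ρ : ℝ := (zC (K (circlePoint s))).re + drawRadius r with hρdef
  have hB : bandStep w x₀ = Real.smoothTransition u₀ := rfl
  have hP : cs * m = ct := by rw [← hup, hPk, hlow]
  have hρeq : (zC (K (circlePoint t))).re + drawRadius r = ρ := by rw [hρdef, hts]
  -- the trichotomy at `u₀`
  rcases hk₁ k hk u₀ hu₀mem with hfast | hslow | hslow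
  · -- FAST: transversality
    intro hcross0
    rw [cross_eq_im_conj_mul _ _ 0 0, hVs', hVt'] at hcross0
    have hframe := im_conj_mul_frame ct (vs * m + cs * (m * ((lam : ℂ) * I))) vt
    rw [hcross0, mul_zero] at hframe
    have ha : conj ct * (vs * m + cs * (m * ((lam : ℂ) * I))) =
        conj cs * vs + ((lam * Complex.normSq cs : ℝ) : ℂ) * I := by
      rw [← hP, show vs * m + cs * (m * ((lam : ℂ) * I)) = (vs + cs * ((lam : ℂ) * I)) * m by ring]
      exact frame_upper cs vs m lam hm1
    rw [ha, Complex.mul_im, Complex.conj_re, Complex.conj_im, re_add_real_mul_I,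
      im_add_real_mul_I, hrs, hrt, hρeq, hnormSq] at hframe
    set D : ℝ := 2 * Real.pi * k * deriv Real.smoothTransition u₀ / (2 * w) with hD
    have hDpos : 2 * M₀ / ρmin ^ 2 < D := hfast
    have hD0 : 0 ≤ D := le_trans (by positivity) hDpos.le
    have hlamD : lam = D * deriv f s := by rw [hlam, hB', hkk, hD]; ring
    have hD2 : 2 * M₀ < D * ρ ^ 2 := by
      have h1 : 2 * M₀ < D * ρmin ^ 2 := by rwa [div_lt_iff₀ (by positivity)] at hDpos
      have h2 : D * ρmin ^ 2 ≤ D * ρ ^ 2 := by gcongr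
      linarith
    refine fast_case_absurd (ρ := ρ) (ωs := (conj cs * vs).im) (ωt := (conj ct * vt).im)
      (fs := deriv f s) (ft := deriv f t) (lam := lam) (M₀ := M₀) (D := D) ?_ hρpos has hat hfs0
      hft0 hlamD hD2 hD0
    linear_combination hframe
  · -- SLOW (left end): `m` is close to `1`, contradicting the distance bound
    exfalso
    have hmclose : ‖m - 1‖ < δ₀ / ρmax := by
      rw [hm, hkk, hB]
      exact norm_exp_phase_sub_one_lt_left (Real.smoothTransition.nonneg _) hslow
    have h := norm_sub_lt_of_phase_close hP hρmax hρmax_ge hmclose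
    linarith
  · -- SLOW (right end)
    exfalso
    have hmclose : ‖m - 1‖ < δ₀ / ρmax := by
      rw [hm, hkk, hB]
      exact norm_exp_phase_sub_one_lt_right (Real.smoothTransition.le_one _) hslow
    have h := norm_sub_lt_of_phase_close hP hρmax hρmax_ge hmclose
    linarith

/-! ## Assembly: the twisted pictures are eventually in general position -/

/-- The crossing-value hypothesis in the form produced by `exists_generic_bands`
(`∀ s ∈ crossingSet, …`) gives the pointwise form used above. [folklore] -/
theorem hcross_of_crossingSet {K : 𝕊 1 → 𝔼 4} {K₃ : Knot} {w : ℝ} {e : Fin r → ℝ}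
    (h : ∀ j : Fin r, ∀ s ∈ Knot.crossingSet K₃, (zC (K (circlePoint s))).re ∉
      Icc ((holeCentre r j).re + e j - w) ((holeCentre r j).re + e j + w)) :
    ∀ s t, K₃.planeCurve s = K₃.planeCurve t → circlePoint s ≠ circlePoint t →
      ∀ j : Fin r, (zC (K (circlePoint s))).re ∉
        Icc ((holeCentre r j).re + e j - w) ((holeCentre r j).re + e j + w) := by
  intro s t hst hne j
  set y : ℝ := toIcoMod Real.two_pi_pos 0 s with hy
  have hys : y = s - toIcoDiv Real.two_pi_pos 0 s • (2 * Real.pi) := by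
    rw [hy, ← self_sub_toIcoDiv_zsmul]
  have hymem : y ∈ Ico 0 (2 * Real.pi) := by
    have h1 := toIcoMod_mem_Ico Real.two_pi_pos 0 s
    rwa [zero_add] at h1
  have hcy : circlePoint y = circlePoint s := by
    rw [hys]; exact periodic_circlePoint.sub_zsmul_eq _
  have hpy : K₃.planeCurve y = K₃.planeCurve s := by
    rw [hys]; exact K₃.periodic_planeCurve.sub_zsmul_eq _
  have hmem : y ∈ Knot.crossingSet K₃ :=
    ⟨hymem, t, by rw [hcy]; exact hne.symm, by rw [hpy]; exact hst⟩
  have := h j y hmem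
  rwa [hcy] at this

/-- **The twisted pictures are eventually in general position.**  If the picture `D(0⃗)(K)` of a
core-missing model knot is in general position and the bands are generic (crossing values and
critical values of `Re z` off the closed windows, `MMSWBandGenericity.exists_generic_bands`),
then for all `k ≥ k₁` the picture `D(0⃗)(stripTwistAt_k ∘ K)` is in general position (hence has
a Gauss diagram, `InGeneralPosition.hasGaussDiagram`). [cite: ManolescuMarengonSarkarWillis2023, §8.1] -/
theorem eventually_inGeneralPosition_twisted {K : 𝕊 1 → 𝔼 4} (hK : IsModelKnot r K)
    (hwK : ∀ t, wC (K t) ≠ 0) {K₃ : Knot} (hK₃ : ⇑K₃ = finiteApprox r 0 K)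
    (hgp : K₃.InGeneralPosition) {w : ℝ} (hw : 0 < w) {e : Fin r → ℝ} (he : ∀ j, |e j| + w < 1)
    (hcross : ∀ j : Fin r, ∀ s ∈ Knot.crossingSet K₃, (zC (K (circlePoint s))).re ∉
      Icc ((holeCentre r j).re + e j - w) ((holeCentre r j).re + e j + w))
    (hcrit : ∀ (j : Fin r) (θ : ℝ), deriv (fun θ : ℝ ↦ (zC (K (circlePoint θ))).re) θ = 0 →
      (zC (K (circlePoint θ))).re ∉
        Icc ((holeCentre r j).re + e j - w) ((holeCentre r j).re + e j + w)) :
    ∃ k₁ : ℕ, ∀ k : ℕ, k₁ ≤ k → ∀ K₃k : Knot,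
      ⇑K₃k = finiteApprox r 0 (stripTwistAt r (k : ℤ) w e ∘ K) → K₃k.InGeneralPosition := by
  have hcross' := hcross_of_crossingSet hcross
  obtain ⟨k₁, hk₁⟩ := twisted_transverse_new hK hwK hK₃ hw he hcross' hcrit
  refine ⟨k₁, fun k hk K₃k hK₃k ↦ ⟨?_, ?_, ?_, ?_⟩⟩
  · exact fun x ↦ ne_northPole_of_coe_eq_finiteApprox hK₃k x
  · exact deriv_planeCurve_twisted_ne_zero hK hwK hK₃ hw he hK₃k hgp.deriv_ne_zero hcrit
  · intro s t hst
    by_cases hcp : circlePoint s = circlePoint t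
    · exact Or.inl hcp
    right
    rcases twisted_doublePoint_dichotomy hK hwK hK₃ hw he hK₃k hcross' hst hcp with
      ⟨hold, hoff⟩ | ⟨j, hj, hrad, hsign⟩
    · exact twisted_transverse_old hK hK₃ hgp hw hK₃k hold hcp (fun j ↦ (hoff j).1)
        fun j ↦ (hoff j).2
    · rcases hsign with ⟨hs, ht⟩ | ⟨hs, ht⟩
      · exact hk₁ k hk K₃k hK₃k s t j hj hrad hs ht hst
      · have hj' : (zC (K (circlePoint t))).re ∈
            Ioo ((holeCentre r j).re + e j - w) ((holeCentre r j).re + e j + w) := by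
          rw [hrad]; exact hj
        have h := hk₁ k hk K₃k hK₃k t s j hj' hrad.symm ht hs hst.symm
        rwa [cross_swap, neg_ne_zero] at h
  · exact twisted_no_triple hK hwK hK₃ hgp hw he hK₃k hcross'

end MMSW

end Literature.Topology.FourManifolds

end
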